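import Summits.MatrixMultiplication.MatrixMultiplication.Theorems.SoloInformedDoorLikeRank
import HarnessLib

/-!
# The converse door is closed at every finite level, over every field

Solo programme `solo-MatrixMultiplication-informed`, generation 28, §2o(7) of the sharpest
statement.  Door D1 is `R̃(T_{cw,2}) = 3 ⟹ ω = 2`; the converse asks whether `ω = 2` forces
`R̃(T_{cw,2}) = 3`, and the one mechanism in sight is a flattening-tight embedding of a Kronecker
power of the door tensor into a matrix multiplication tensor, `⟨m,m,m⟩ ⊵ T^{⊠N}` with `m² = 3^N`
(the three flattenings of `T^{⊠N}` have rank `3^N`, so `ab, bc, ca ≥ 3^N` for any `⟨a,b,c⟩ ⊵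
T^{⊠N}`, and tightness `abc = 3^{3N/2}` forces `a = b = c = m`, `m² = 3^N`).
`SoloInformedConverseDoorTwo` / `…TwoSkew` excluded the first level `⟨3,3,3⟩ ⊵ T ⊠ T` over every
field by `161`-pivot certificates.  Here ALL levels are excluded at once, over every field, by a
structural count of the two-leg annihilator `𝔞(T) = {(X,Y) : X·₁T + Y·₂T = 0}`
(`SoloInformedDoorLikeRank`):

* `𝔞(T^{⊠N})` is the line `K·(1,-1)` for `T ∈ {T_{cw,2}, T_{skewcw,2}, P}` and every `N`
  (`DoorLike` is decided on `{0,1,2}` and inherited by Kronecker powers), so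
  `rank O_{T^{⊠N}} = 2·9^N - 1`;
* `𝔞(⟨m,m,m⟩) ⊇ gl_m`, so `rank O_{⟨m,m,m⟩} ≤ 2m⁴ - m²`;
* `rank O` does not increase under degeneration (`rank_orbitForm_le_of_polyDegeneratesTo`, every
  characteristic), and `2m⁴ - m² < 2m⁴ - 1` once `m ≥ 2`.

Main results (every field `K`, no characteristic hypothesis):
`not_matMul_polyDegeneratesTo_of_doorLike` (`⟨m,m,m⟩ ⋭ T` for any door-like `T` of format
`m²`, `m ≥ 2`), and for `m² = 3^N`, `m ≥ 2`:
`not_matMul_polyDegeneratesTo_cwTwo_pow`, `…_skewCwTwo_pow`, `…_sThree_pow`; in particular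
`⟨3^k,3^k,3^k⟩ ⋭ T_{cw,2}^{⊠2k}`, `T_{skewcw,2}^{⊠2k}`, `P^{⊠2k}` for every `k ≥ 1`
(`…_evenPow`).  Over `ℂ` this is the orbit-dimension statement "`dim G·⟨m,m,m⟩ < dim G·T^{⊠N}`"
restricted to two factors; the point is that two factors and the SUPPORT of `T` suffice, so no
Lie theory and no characteristic enter.  Sources: [cite: ConnerGesmundoLandsbergVentura2022,
§3.2 and Remark 3.4] (symmetry groups of `perm₃ = T_{cw,2}^{⊠2}`, `det₃ = T_{skewcw,2}^{⊠2}` and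
the Pascal determinants); [cite: Alman2021, §2.4] (degeneration); [cite: Blaser2013, §5]
(`⟨k,m,n⟩`).  Everything here is PROVED; no new axioms.
-/

namespace Summit.MatrixMultiplication.MatrixMultiplication.Theorems

open Matrix Finset Module
open Literature.Computability.AlgebraicComplexity Literature.Barriers.MatrixMultiplication

universe u

set_option linter.unusedSectionVars false

namespace OrbitRankGen

/-! ## Reindexing -/

section Reindex

variable {K : Type u} [Field K]

/-- Relabelling the source of a degeneration along bijections. [cite: Alman2021, §2.4] -/
theorem polyDegeneratesTo_reindex {α β γ ι' κ' μ' J₁ J₂ J₃ : Type*} [Fintype α] [Fintype β]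
    [Fintype γ] [Fintype J₁] [Fintype J₂] [Fintype J₃] (e₁ : J₁ ≃ α) (e₂ : J₂ ≃ β) (e₃ : J₃ ≃ γ)
    {t : α → β → γ → K} {s : ι' → κ' → μ' → K} (h : PolyDegeneratesTo t s) :
    PolyDegeneratesTo (fun a b c => t (e₁ a) (e₂ b) (e₃ c)) s := by
  obtain ⟨h, A, B, C, H⟩ := h
  refine ⟨h, fun a a' => A (e₁ a) a', fun b b' => B (e₂ b) b', fun c c' => C (e₃ c) c',
    fun a' b' c' j hj => ?_⟩
  rw [← H a' b' c' j hj]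
  congr 1
  refine Fintype.sum_equiv e₁ _ _ fun a => ?_
  refine Fintype.sum_equiv e₂ _ _ fun b => ?_
  exact Fintype.sum_equiv e₃ _ _ fun c => rfl

variable {ι ι₂ : Type} [Fintype ι] [DecidableEq ι] [Fintype ι₂] [DecidableEq ι₂]

/-- `rank O` is invariant under relabelling the index set. [folklore] -/
theorem rank_orbitForm_reindex (e : ι₂ ≃ ι) (T : ι → ι → ι → K) :
    (orbitForm (fun a b c => T (e a) (e b) (e c))).rank = (orbitForm T).rank := by
  have h : orbitForm (fun a b c => T (e a) (e b) (e c)) =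
      Matrix.reindex (e.prodCongr (e.prodCongr e)).symm
        ((Equiv.refl (Fin 2)).prodCongr (e.prodCongr e)).symm (orbitForm T) := by
    ext v w
    obtain ⟨a, b, c⟩ := v
    obtain ⟨f, p, q⟩ := w
    simp only [Matrix.reindex_apply, Matrix.submatrix_apply, Equiv.symm_symm, orbitForm_apply,
      Equiv.prodCongr_apply, Prod.map, Equiv.refl_apply, e.apply_eq_iff_eq]
  rw [h, Matrix.rank_reindex]

end Reindex

end OrbitRankGen

namespace ConverseDoorAll

open OrbitRankGen

variable {K : Type u} [Field K]

/-! ## `⟨m,m,m⟩` degenerates to no door-like tensor of its own format -/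

/-- `⟨m,m,m⟩` over `ℤ` read in `K` is `⟨m,m,m⟩` over `K`. [cite: Blaser2013, §5] -/
theorem matMulTensor_intCast (m : ℕ) (a b c : Fin m × Fin m) :
    ((matMulTensor ℤ m m m a b c : ℤ) : K) = matMulTensor K m m m a b c := by
  unfold matMulTensor
  split_ifs <;> simp

/-- **`⟨m,m,m⟩ ⋭ T` for every door-like `T` of format `m²`, `m ≥ 2`, over every field**:
`rank O_T ≥ 2m⁴ - 1 > 2m⁴ - m² ≥ rank O_{⟨m,m,m⟩}` and `rank O` is monotone under degeneration.
[cite: ConnerGesmundoLandsbergVentura2022, §3.2] -/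
theorem not_matMul_polyDegeneratesTo_of_doorLike {J : Type} [Fintype J] [DecidableEq J]
    {T : J → J → J → K} (hT : DoorLike T) (m : ℕ) (hm : 2 ≤ m)
    (hJ : Fintype.card J = m * m) : ¬ PolyDegeneratesTo (matMulTensor K m m m) T := by
  intro h
  have hc : Fintype.card J = Fintype.card (Fin m × Fin m) := by simp [hJ]
  obtain ⟨e⟩ : Nonempty (J ≃ Fin m × Fin m) := Fintype.card_eq.1 hc
  set S : J → J → J → ℤ := fun a b c => matMulTensor ℤ m m m (e a) (e b) (e c) with hSdef
  have hS : ∀ (L : Type u) [Field L], (fun a b c => (S a b c : L)) =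
      fun a b c => matMulTensor L m m m (e a) (e b) (e c) := by
    intro L _
    funext a b c
    exact matMulTensor_intCast m _ _ _
  have h' : PolyDegeneratesTo (fun a b c => (S a b c : K)) T := by
    rw [hS K]
    exact polyDegeneratesTo_reindex e e e h
  have hup : (orbitForm T).rank ≤ 2 * ((m * m) * (m * m)) - m * m :=
    rank_orbitForm_le_of_polyDegeneratesTo S h' fun L _ _ => by
      rw [hS L, rank_orbitForm_reindex e]
      exact rank_orbitForm_matMul_le m
  have hlo := hT.le_rank
  rw [hJ] at hlo
  set n := m * m with hn
  have h4 : 4 ≤ n := by rw [hn]; nlinarith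
  set n2 := n * n with hn2
  have h16 : 16 ≤ n2 := by rw [hn2]; nlinarith
  omega

/-! ## The three door tensors are door-like -/

/-- `T_{cw,2}` over `ℤ` has door-like support (decided on `{0,1,2}`).
[cite: ConnerGesmundoLandsbergVentura2022, §3.2] -/
def doorLike_cwTwoInt : DoorLike CayleyOmega.cwTwoInt :=
  ⟨by decide, by decide, by decide, by decide, by decide, by decide⟩

/-- The entries of `T_{cw,2}` over `ℤ` lie in `{0, 1, -1}`. [folklore] -/
theorem cwTwoInt_mem : ∀ a b c, CayleyOmega.cwTwoInt a b c = 0 ∨ CayleyOmega.cwTwoInt a b c = 1 ∨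
    CayleyOmega.cwTwoInt a b c = -1 := by decide

/-- `T_{cw,2}` is door-like over every field. [cite: ConnerGesmundoLandsbergVentura2022, §3.2] -/
noncomputable def doorLike_cwTensor_two : DoorLike (cwTensor K 2) := by
  rw [CayleyOmega.cwTensor_two_eq_cast]
  exact doorLike_cwTwoInt.intCast cwTwoInt_mem

/-- `T_{skewcw,2}` over `ℤ`: the tree's formula for `skewCwTensor R u` at `u = 1`.
[cite: ConnerGesmundoLandsbergVentura2022, eq. (3)] -/
def skewTwoZ : Fin 3 → Fin 3 → Fin 3 → ℤ := fun i j k =>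
  if (i = 0 ∧ j = k ∧ j ≠ 0) ∨ (j = 0 ∧ i = k ∧ i ≠ 0) then 1
  else if k = 0 ∧ 1 ≤ (i : ℕ) ∧ (i : ℕ) ≤ 1 ∧ (j : ℕ) = i + 1 then 1
  else if k = 0 ∧ 1 ≤ (j : ℕ) ∧ (j : ℕ) ≤ 1 ∧ (i : ℕ) = j + 1 then -1
  else 0

/-- The tree's `skewCwTensor K 1` is `skewTwoZ` read in `K`.
[cite: ConnerGesmundoLandsbergVentura2022, eq. (3)] -/
theorem skewCwTensor_one_eq_cast_skewTwoZ :
    skewCwTensor K 1 = fun i j k => (skewTwoZ i j k : K) := by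
  funext i j k
  simp only [skewCwTensor, skewTwoZ]
  split_ifs <;> simp

/-- `T_{skewcw,2}` over `ℤ` has door-like support.
[cite: ConnerGesmundoLandsbergVentura2022, §3.2] -/
def doorLike_skewTwoZ : DoorLike skewTwoZ :=
  ⟨by decide, by decide, by decide, by decide, by decide, by decide⟩

/-- The entries of `T_{skewcw,2}` over `ℤ` lie in `{0, 1, -1}`. [folklore] -/
theorem skewTwoZ_mem : ∀ a b c, skewTwoZ a b c = 0 ∨ skewTwoZ a b c = 1 ∨ skewTwoZ a b c = -1 := by
  decide

/-- `T_{skewcw,2}` is door-like over every field.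
[cite: ConnerGesmundoLandsbergVentura2022, §3.2] -/
noncomputable def doorLike_skewCwTensor_one : DoorLike (skewCwTensor K 1) := by
  rw [skewCwTensor_one_eq_cast_skewTwoZ]
  exact doorLike_skewTwoZ.intCast skewTwoZ_mem

/-- `P = Σ_{σ ∈ S₃} e_σ` over `ℤ` has door-like support.
[cite: ConnerGesmundoLandsbergVentura2022, §3.2] -/
def doorLike_sThreeInt : DoorLike sThreeInt :=
  ⟨by decide, by decide, by decide, by decide, by decide, by decide⟩

/-- The entries of `P` lie in `{0, 1, -1}`. [folklore] -/
theorem sThreeInt_mem :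
    ∀ a b c, sThreeInt a b c = 0 ∨ sThreeInt a b c = 1 ∨ sThreeInt a b c = -1 := by
  decide

/-- `P` is door-like over every field. [cite: ConnerGesmundoLandsbergVentura2022, §3.2] -/
noncomputable def doorLike_sThree : DoorLike (sThree K) :=
  doorLike_sThreeInt.intCast sThreeInt_mem

/-! ## The converse door at every finite level -/

/-- `|{0,1,2}^N| = 3^N`. [folklore] -/
theorem card_fin_fun_three (N : ℕ) : Fintype.card (Fin N → Fin 3) = 3 ^ N := by simp

/-- **`⟨m,m,m⟩ ⋭ T_{cw,2}^{⊠N}` whenever `m² = 3^N`, `m ≥ 2`, over every field.**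
[cite: ConnerGesmundoLandsbergVentura2022, §3.2] -/
theorem not_matMul_polyDegeneratesTo_cwTwo_pow (m N : ℕ) (hm : 2 ≤ m) (hN : 3 ^ N = m * m) :
    ¬ PolyDegeneratesTo (matMulTensor K m m m) (kroneckerPow (cwTensor K 2) N) :=
  not_matMul_polyDegeneratesTo_of_doorLike ((doorLike_cwTensor_two (K := K)).kroneckerPow N) m hm
    ((card_fin_fun_three N).trans hN)

/-- **`⟨m,m,m⟩ ⋭ T_{skewcw,2}^{⊠N}` whenever `m² = 3^N`, `m ≥ 2`, over every field.**
[cite: ConnerGesmundoLandsbergVentura2022, Remark 3.4] -/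
theorem not_matMul_polyDegeneratesTo_skewCwTwo_pow (m N : ℕ) (hm : 2 ≤ m) (hN : 3 ^ N = m * m) :
    ¬ PolyDegeneratesTo (matMulTensor K m m m) (kroneckerPow (skewCwTensor K 1) N) :=
  not_matMul_polyDegeneratesTo_of_doorLike ((doorLike_skewCwTensor_one (K := K)).kroneckerPow N)
    m hm ((card_fin_fun_three N).trans hN)

/-- **`⟨m,m,m⟩ ⋭ P^{⊠N}` whenever `m² = 3^N`, `m ≥ 2`, over every field.**
[cite: ConnerGesmundoLandsbergVentura2022, §3.2] -/
theorem not_matMul_polyDegeneratesTo_sThree_pow (m N : ℕ) (hm : 2 ≤ m) (hN : 3 ^ N = m * m) :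
    ¬ PolyDegeneratesTo (matMulTensor K m m m) (kroneckerPow (sThree K) N) :=
  not_matMul_polyDegeneratesTo_of_doorLike ((doorLike_sThree (K := K)).kroneckerPow N) m hm
    ((card_fin_fun_three N).trans hN)

/-- `2 ≤ 3^k` for `k ≥ 1`. [folklore] -/
theorem two_le_three_pow {k : ℕ} (hk : 1 ≤ k) : 2 ≤ 3 ^ k :=
  le_trans (by norm_num) (Nat.pow_le_pow_right (by norm_num) hk)

/-- `3^{2k} = 3^k · 3^k`. [folklore] -/
theorem three_pow_two_mul (k : ℕ) : 3 ^ (2 * k) = 3 ^ k * 3 ^ k := by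
  rw [two_mul, pow_add]

/-- **The converse door, `T_{cw,2}`: `⟨3^k,3^k,3^k⟩ ⋭ T_{cw,2}^{⊠2k}` for every `k ≥ 1` over
every field** — no flattening-tight matrix multiplication tensor degenerates to a Kronecker power
of the door tensor. [cite: ConnerGesmundoLandsbergVentura2022, §3.2] -/
theorem not_matMul_polyDegeneratesTo_cwTwo_evenPow (k : ℕ) (hk : 1 ≤ k) :
    ¬ PolyDegeneratesTo (matMulTensor K (3 ^ k) (3 ^ k) (3 ^ k))
      (kroneckerPow (cwTensor K 2) (2 * k)) :=
  not_matMul_polyDegeneratesTo_cwTwo_pow (3 ^ k) (2 * k) (two_le_three_pow hk)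
    (three_pow_two_mul k)

/-- **The converse door, `T_{skewcw,2}`: `⟨3^k,3^k,3^k⟩ ⋭ T_{skewcw,2}^{⊠2k}` (the Pascal
determinant `PasDet_{k,3}`) for every `k ≥ 1` over every field.**
[cite: ConnerGesmundoLandsbergVentura2022, Remark 3.4] -/
theorem not_matMul_polyDegeneratesTo_skewCwTwo_evenPow (k : ℕ) (hk : 1 ≤ k) :
    ¬ PolyDegeneratesTo (matMulTensor K (3 ^ k) (3 ^ k) (3 ^ k))
      (kroneckerPow (skewCwTensor K 1) (2 * k)) :=
  not_matMul_polyDegeneratesTo_skewCwTwo_pow (3 ^ k) (2 * k) (two_le_three_pow hk)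
    (three_pow_two_mul k)

/-- **The converse door, `P`: `⟨3^k,3^k,3^k⟩ ⋭ P^{⊠2k}` for every `k ≥ 1` over every field.**
[cite: ConnerGesmundoLandsbergVentura2022, §3.2] -/
theorem not_matMul_polyDegeneratesTo_sThree_evenPow (k : ℕ) (hk : 1 ≤ k) :
    ¬ PolyDegeneratesTo (matMulTensor K (3 ^ k) (3 ^ k) (3 ^ k))
      (kroneckerPow (sThree K) (2 * k)) :=
  not_matMul_polyDegeneratesTo_sThree_pow (3 ^ k) (2 * k) (two_le_three_pow hk)
    (three_pow_two_mul k)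

/-- The three converse doors bundled: for every `k ≥ 1` and every field, `⟨3^k,3^k,3^k⟩`
degenerates to none of `T_{cw,2}^{⊠2k}`, `T_{skewcw,2}^{⊠2k}`, `P^{⊠2k}`.
[cite: ConnerGesmundoLandsbergVentura2022, §3.2 and Remark 3.4] -/
theorem converseDoors_closed_everyLevel (k : ℕ) (hk : 1 ≤ k) :
    ¬ PolyDegeneratesTo (matMulTensor K (3 ^ k) (3 ^ k) (3 ^ k))
        (kroneckerPow (cwTensor K 2) (2 * k)) ∧
      ¬ PolyDegeneratesTo (matMulTensor K (3 ^ k) (3 ^ k) (3 ^ k))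
        (kroneckerPow (skewCwTensor K 1) (2 * k)) ∧
      ¬ PolyDegeneratesTo (matMulTensor K (3 ^ k) (3 ^ k) (3 ^ k))
        (kroneckerPow (sThree K) (2 * k)) :=
  ⟨not_matMul_polyDegeneratesTo_cwTwo_evenPow k hk,
    not_matMul_polyDegeneratesTo_skewCwTwo_evenPow k hk,
    not_matMul_polyDegeneratesTo_sThree_evenPow k hk⟩

end ConverseDoorAll

end Summit.MatrixMultiplication.MatrixMultiplication.Theorems
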